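import Mathlib
import Summits.NavierStokesRegularity.NavierStokesRegularity.Theses.RootDecompLeanestSingularity

/-!
# N14's layer-2 split of the lean threshold is exact: `N → E → NMT`

Route `RootDecompLeanestSingularity` (decomp-ns node N14), item NMT `LeanThresholdIsTypeI` (stmt-29108) was split
(g11, rev 2) into N `LeanEnvelopedIsTypeI` (stmt-32146, the enveloped/spike corner) and E `LeanTypeIIEnveloped`
(stmt-32147, the non-Type-I ⟹ enveloped corner) with the glue item `LeanThresholdIsTypeI_of_pieces : N → E → NMT`
(stmt-32148). This file proves the glue item: with `ε := min ε_N ε_E`, an `ε`-lean marginal blow-up that is not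
Type I is enveloped by E (leanness is monotone in `ε`), hence Type I by N — contradiction. (Lens-4 g11/g16
`nmt_of_E_N`, re-proved here over the born tree declarations; pure logic plus monotonicity of `ENNReal.ofReal`.)
-/

namespace Summit.NavierStokesRegularity.NavierStokesRegularity.Theorems

open MeasureTheory
open Summit.NavierStokesRegularity.NavierStokesRegularity.Theses.RootDecompLeanestSingularity

/-- Monotonicity of `ε`-leanness in `ε` (the only non-logical step). -/
theorem rootDecompLeanestSingularity_lean_mono {ε ε' ν : ℝ}
    {u₀ : EuclideanSpace ℝ (Fin 3) → EuclideanSpace ℝ (Fin 3)} (hle : ε ≤ ε')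
    (h : ∀ v : EuclideanSpace ℝ (Fin 3) → EuclideanSpace ℝ (Fin 3),
      (ContDiff ℝ (⊤ : ℕ∞) v ∧ Literature.Analysis.FluidPDE.NSWave0.IsDivFree v ∧
        Literature.Analysis.FluidPDE.HasRapidSpatialDecay v) →
      ¬ Literature.Analysis.FluidPDE.HasGlobalKatoSolution ν v →
        eLpNorm u₀ 3 volume ≤ ENNReal.ofReal (1 + ε) * eLpNorm v 3 volume) :
    ∀ v : EuclideanSpace ℝ (Fin 3) → EuclideanSpace ℝ (Fin 3),
      (ContDiff ℝ (⊤ : ℕ∞) v ∧ Literature.Analysis.FluidPDE.NSWave0.IsDivFree v ∧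
        Literature.Analysis.FluidPDE.HasRapidSpatialDecay v) →
      ¬ Literature.Analysis.FluidPDE.HasGlobalKatoSolution ν v →
        eLpNorm u₀ 3 volume ≤ ENNReal.ofReal (1 + ε') * eLpNorm v 3 volume := by
  intro v hv hb
  refine (h v hv hb).trans ?_
  gcongr

/-- The glue item of N14's split, proved: `LeanEnvelopedIsTypeI → LeanTypeIIEnveloped → LeanThresholdIsTypeI`. -/
theorem rootDecompLeanestSingularity_leanThresholdIsTypeI_of_pieces_proof :
    Summit.NavierStokesRegularity.NavierStokesRegularity.Theses.RootDecompLeanestSingularity.LeanThresholdIsTypeI_of_pieces := by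
  intro hN hE
  obtain ⟨εN, hεN, hN⟩ := hN
  obtain ⟨εE, hεE, hE⟩ := hE
  refine ⟨min εE εN, lt_min hεE hεN, ?_⟩
  intro ν T hν hT u p hmax hLH hdec hmarg hlean
  by_contra hII
  have henv := hE ν T hν hT u p hmax hLH hdec hmarg
    (rootDecompLeanestSingularity_lean_mono (min_le_left _ _) hlean) hII
  exact hII (hN ν T hν hT u p hmax hLH hdec hmarg
    (rootDecompLeanestSingularity_lean_mono (min_le_right _ _) hlean) henv)

/-- Converse restrictions: NMT ⟹ N and NMT ⟹ E (so the split is EXACT: NMT ↔ N ∧ E). -/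
theorem rootDecompLeanestSingularity_pieces_of_leanThreshold (h : LeanThresholdIsTypeI) :
    LeanEnvelopedIsTypeI ∧ LeanTypeIIEnveloped := by
  obtain ⟨ε, hε, h⟩ := h
  exact ⟨⟨ε, hε, fun ν T hν hT u p hmax hLH hdec hmarg hlean _ => h ν T hν hT u p hmax hLH hdec hmarg hlean⟩,
    ⟨ε, hε, fun ν T hν hT u p hmax hLH hdec hmarg hlean hII => (hII (h ν T hν hT u p hmax hLH hdec hmarg hlean)).elim⟩⟩

/-- EXACTNESS of N14's split on the tree decls. -/
theorem rootDecompLeanestSingularity_leanThreshold_iff_pieces :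
    LeanThresholdIsTypeI ↔ LeanEnvelopedIsTypeI ∧ LeanTypeIIEnveloped :=
  ⟨rootDecompLeanestSingularity_pieces_of_leanThreshold,
    fun h => rootDecompLeanestSingularity_leanThresholdIsTypeI_of_pieces_proof h.1 h.2⟩

end Summit.NavierStokesRegularity.NavierStokesRegularity.Theorems
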